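import Summits.QuantumFields.YangMills.Theorems.UnitScaleTiltProp8FlatPortRechart
import Summits.QuantumFields.YangMills.Theorems.UnitScaleTiltProp8FlatPortKernelRowsL0
import HarnessLib

/-!
# Route `UnitScaleTilt`, crux K1 child «MinimiserStabilityRegPr» (stmt-QuantumFields-19200), v8 pillar **P2 `stub_flatOpsCubeSeq`** — THE PORT BRIDGE, file 11:
# **RE-CHARTING WITH SMALLER BIG BLOCKS**: an `Adm22 D R M` family is `Adm22 D R M′` for every `M′ ∣ M` ((2.1): an `M`-block is a union of `M′`-blocks; (2.2): `R·M′ ≤ R·M`), so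
# file 9's torus-size condition `a′ + 3 ≤ m + n` (at least `5L` big blocks per direction) can be met with the SMALLEST admissible big block `L^{a₀}` — the residual
# small-torus regime of P2 becomes the FINITE set of sizes `m + n ≤ a₀(L) + 2`, independent of the datum's `M`

**LEVEL-0 TWIN** of `UnitScaleTiltProp8FlatPortRechart` (GAP LIST v22 (P2-L0)): the same statements for lit-balaban's LEVEL-0-ADMITTING torus families
`B6MultiLevelTorusOperatorL0.TDomains` (blocks of every level `0 ≤ j ≤ k` — the P2 text's `Adm22` families have unit cubes `Λ₀ ≠ ∅` in general), obtained from the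
gen-17 file by the dictionary swap `B6GlobalChartV1L0.{blkV1, domT}`, `B6Geom246MultiLevel{Box,Torus}L0`, `B6Ineq2142KLevelV1L0.β`, the `…KLevelV1L0` rows of
lit-balaban's S-E port, and `UnitScaleTiltProp8FlatPort*L0`; the `D`-free lemmas of the gen-17 file (`adm22_of_dvd`) are reused by name, not restated.  TWO STRENGTHENINGS over the gen-17 statements: (a) the `D.Om 1 = univ` binder is GONE (every `Adm22` family, unit cubes `Λ₀` allowed);
(b) UNIFORMITY IN THE FAMILY MEMBER — the constants are chosen from `L` alone, BEFORE the volume exponent `m` (`∃ consts, ∀ m (hm : 1 ≤ m) n K …`; the gen-17 files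
quantified `m` first), as `FlatCubeOpsText.FlatOpsAdmAtMS L …` (`∀ F, F.L = L → …`) requires.  Seat `ym3-torus-p1` gen 18.

Cell `ym3-torus` (HUMAN RULING D-0037, YM ladder rung R3), seat `ym3-torus-p1` gen 17.  `--supports stmt-QuantumFields-19200 --as helper`; count-neutral; def-free.

WHAT IS PROVED (sorry-free; axioms standard; no definition; `FlatPortRechart.adm22_of_dvd` reused): **`kernelRowsAt_of_adm22_pow`**: for odd
`L = ℓ + 1 ≥ 5`, `m ≥ 1` there are `a₀, R₀ : ℕ` and `C ≥ 0`, `δ₀ > 0`, `B₃ > 0`, `C_G ≥ 0` such that for all heights `1 ≤ K − n`, `K − n + 1 ≤ m + K` with `a₀ + 3 ≤ m + n`, EVERY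
big-block exponent `a ≥ a₀ + 1` (`M = Lᵃ`), every `R ≥ R₀`, every `D : Domains (F.P K)` with `D.k = K − n`, `Adm22 D R (Lᵃ)` (unit cubes `Λ₀` allowed) and every P2 weight family:
`KernelRowsAt F n K D w C δ₀ B₃ C_G` — the binder shape of the registered text (`M₀ ≤ M`, `M = Lᵃ`, `R₀ ≤ R`) up to `L ≥ 5` and the finite small-torus set.
HONEST SCOPE: bookkeeping over file 9; NOT a claim about the mass gap.

References: T. Bałaban, CMP **96** (1984) 223–250 [Balaban1984PropagatorsII] (2.1)–(2.2) p.224; CMP **102** (1985) 277–309 [Balaban1985Variational] (161)–(163) p.303.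
-/

set_option autoImplicit false

noncomputable section

namespace Summit.QuantumFields.YangMills.Theorems.FlatPortRechartL0

open FlatPortRechart (adm22_of_dvd)

open Literature.MathematicalPhysics.QuantumFieldTheory.Balaban1983to89
open B5Eq117TorusCarriers (Mk)
open B5Prop12FieldsLattice (distSite)
open B6GlobalChartV1 (PV)
open B6SectADomainsV1 (Domains)
open T3ContinuumYM3Torus (T3Family)
open FlatCubeOpsText (Adm22 IsLevWeight)
open FlatOpsFromKernelRows (KernelRowsAt)
open FlatPortKernelRowsL0 (kernelRowsAt_of_adm22)

/-- `1 ≤ 3` (named once). [folklore] -/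
private theorem hd3 : 1 ≤ 2 + 1 := by norm_num

/-- **`KernelRowsAt` AT EVERY ADMISSIBLE FAMILY (UNIT CUBES `Λ₀` ALLOWED — NO `Ω₁ = T`) IN THE REGISTERED TEXT's BINDER SHAPE** (`M = Lᵃ`, `a ≥ a₀ + 1`, `R ≥ R₀`; torus size `a₀ + 3 ≤ m + n` only):
re-chart with the smallest admissible big block `L·L^{a₀}` (`adm22_of_dvd`) and apply file 9's `kernelRowsAt_of_adm22`.
[cite: Balaban1984PropagatorsII, (2.1)-(2.4) p.224, Cor. 2.8 (2.150)-(2.151) p.249; Balaban1985Variational, (161)-(163) p.303] -/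
theorem kernelRowsAt_of_adm22_pow (ℓ : ℕ) (hL : Odd (ℓ + 1) ∧ 1 < ℓ + 1) (hℓ : 4 ≤ ℓ) :
    ∃ (a₀ R₀ : ℕ) (C δ₀ B₃ CG : ℝ), 0 ≤ C ∧ 0 < δ₀ ∧ 0 < B₃ ∧ 0 ≤ CG ∧
    ∀ (m : ℕ) (hm : 1 ≤ m) (n K : ℕ) (_ : 1 ≤ K - n) (_ : K - n + 1 ≤ m + K) (_ : a₀ + 3 ≤ m + n) {R a : ℕ} (_ : a₀ + 1 ≤ a) (_ : R₀ ≤ R)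
      (D : Domains (PV 2 ℓ m K hd3 hL)) (_ : D.k = K - n) (_ : Adm22 D R ((ℓ + 1) ^ a))
      (w : ℕ → PBond (PV 2 ℓ m K hd3 hL) 0 → ℝ) (_ : IsLevWeight (⟨ℓ + 1, hL, m, hm⟩ : T3Family) n K D w),
      KernelRowsAt (⟨ℓ + 1, hL, m, hm⟩ : T3Family) n K D w C δ₀ B₃ CG := by
  obtain ⟨Mh₀, R₀, C, δ₀, B₃, CG, hC, hδ₀, hB₃, hCG, hmain⟩ := kernelRowsAt_of_adm22 ℓ hL hℓ
  -- `a₀ := Mh₀`: `L^{Mh₀} ≥ Mh₀`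
  refine ⟨Mh₀, R₀, C, δ₀, B₃, CG, hC, hδ₀, hB₃, hCG, ?_⟩
  intro m hm n K hk1 hk' hsize R a ha hR D hDk hAdm w hw
  have hL1 : 1 < ℓ + 1 := by omega
  have hMh : Mh₀ ≤ (ℓ + 1) ^ Mh₀ := (Nat.lt_pow_self hL1).le
  -- re-chart: `L·L^{a₀} ∣ L^a`
  have hdvd : (ℓ + 1) * (ℓ + 1) ^ Mh₀ ∣ (ℓ + 1) ^ a := by
    rw [← pow_succ']
    exact pow_dvd_pow _ (by omega)
  have hAdm' : Adm22 D R ((ℓ + 1) * (ℓ + 1) ^ Mh₀) := adm22_of_dvd hAdm hdvd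
  exact hmain m hm n K hk1 hk' rfl hMh hR hsize D hDk hAdm' w hw

end Summit.QuantumFields.YangMills.Theorems.FlatPortRechartL0

end
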